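import Mathlib
import Summits.QuantumAdvantage.QuantumAdvantage.Theorems.MobiusLadderQuadraticDigitPhasesRankCoreFibre

/-!
# `QuadraticDigitPhases` (stmt-QuantumAdvantage-1391), line `Sketch` — stub `stub_labelFourier`

LABEL FOURIER REDUCTION (§3.7 of the line).  For a solution `μ` of the one-step transfer recursion of
the reduced carry automaton (abstract pattern `a`, linear data `l`, multipliers `p, q ≥ 1`, cut
`N ≤ n`) whose cut matrix `C = (a i j · [i < N ≤ j])` has rank `< R₀`, the `ℓ¹` mass at level `N` is
at most `4^(R₀−1) · M` as soon as every twist of the phase by label characters `ψ, ψ' : ℕ → ZMod 2`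
has cell sum `≤ M`.  Proof: `μ N` is the explicit fibre sum (landed uniqueness
`…RankCoreFibre.eq_fibA_of_recursion`); every pending label is a row-space vector `y(m) ᵥ* C`
(`lab_eq_vecMul`), so cell by cell the function of the label pair is supported on `im C × im C`,
`#im C ≤ 2^{rank Cᵀ} = 2^{rank C} ≤ 2^{R₀−1}` (`card_image_vecMul_le`); Fourier inversion with an
orthogonal system of bounded characters (`inversion`, `l1_le_card_mul_fourier`) gives
`Σ_λ |g λ| ≤ (#supp g / #characters) Σ_χ |ĝ χ|`; the sign characters of `(ZMod 2)^n × (ZMod 2)^n`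
are orthogonal (`orth`, via the product formula `sum_sgn_dot` and characteristic two), and the
Fourier coefficient of the fibre sums at `(ψ, ψ')` is the inner sum of the twisted cell sum at the
characters extended by zero (`coeff_eq`, fibrewise summation `sum_fiber_pair` and the twist identity
`twist_eq`); average the hypothesis over the `4^n` characters (`main_bound`).  All data (sign `σ`,
digits `y`, labels `lab`, phases `φ, Φ`, fibre sums `F`, twisted cell sums `Gh`, cut matrix `C`) are
section variables pinned by defining hypotheses, instantiated by `rfl` in the stub.  Folklore harmonic
analysis on `𝔽₂ⁿ` and linear algebra; Mathlib + `…RankCoreFibre` only.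
-/

set_option linter.dupNamespace false -- D-0017: single-problem summit ⇒ `QuantumAdvantage.QuantumAdvantage` by design

namespace Summit.QuantumAdvantage.QuantumAdvantage.Theorems.MobiusLadderQuadraticDigitPhasesStubLabelFourier

open Finset

/-! ### Fourier inversion for an orthogonal system of bounded characters -/

/-- FOURIER INVERSION for an orthogonal system `χ : X → G → ℝ` (`Σ_Ψ χ_Ψ(Λ) χ_Ψ(Λ') = #X · [Λ = Λ']`):
`#X · g Λ = Σ_Ψ χ_Ψ(Λ) · ĝ(Ψ)` with `ĝ(Ψ) = Σ_{Λ'} χ_Ψ(Λ') g(Λ')`. -/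
theorem inversion {G X : Type*} [Fintype G] [Fintype X] [DecidableEq G] (χ : X → G → ℝ)
    (horth : ∀ Λ Λ', ∑ Ψ, χ Ψ Λ * χ Ψ Λ' = if Λ = Λ' then (Fintype.card X : ℝ) else 0)
    (g : G → ℝ) (Λ : G) : (Fintype.card X : ℝ) * g Λ = ∑ Ψ, χ Ψ Λ * ∑ Λ', χ Ψ Λ' * g Λ' := by
  simp only [Finset.mul_sum]
  rw [Finset.sum_comm]
  simp only [← mul_assoc, ← Finset.sum_mul, horth, ite_mul, zero_mul]
  rw [Finset.sum_ite_eq, if_pos (Finset.mem_univ _)]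

/-- `ℓ¹` FOURIER BOUND WITH SUPPORT: for characters bounded by `1`, if `g` vanishes off `S` then
`Σ_Λ |g Λ| ≤ (#S / #X) Σ_Ψ |ĝ Ψ|`. -/
theorem l1_le_card_mul_fourier {G X : Type*} [Fintype G] [Fintype X] [DecidableEq G] [Nonempty X]
    (χ : X → G → ℝ) (hχ : ∀ Ψ Λ, |χ Ψ Λ| ≤ 1)
    (horth : ∀ Λ Λ', ∑ Ψ, χ Ψ Λ * χ Ψ Λ' = if Λ = Λ' then (Fintype.card X : ℝ) else 0)
    (g : G → ℝ) (S : Finset G) (hS : ∀ Λ, g Λ ≠ 0 → Λ ∈ S) :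
    ∑ Λ, |g Λ| ≤ S.card / (Fintype.card X : ℝ) * ∑ Ψ, |∑ Λ', χ Ψ Λ' * g Λ'| := by
  have hX : (0 : ℝ) < Fintype.card X := by exact_mod_cast Fintype.card_pos
  have key : ∀ Λ, |g Λ| ≤ (Fintype.card X : ℝ)⁻¹ * ∑ Ψ, |∑ Λ', χ Ψ Λ' * g Λ'| := by
    intro Λ
    have hg : g Λ = (Fintype.card X : ℝ)⁻¹ * ∑ Ψ, χ Ψ Λ * ∑ Λ', χ Ψ Λ' * g Λ' := by
      rw [← inversion χ horth g Λ, ← mul_assoc, inv_mul_cancel₀ hX.ne', one_mul]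
    rw [hg, abs_mul, abs_inv, abs_of_pos hX]
    refine mul_le_mul_of_nonneg_left ?_ (inv_nonneg.2 hX.le)
    refine (Finset.abs_sum_le_sum_abs _ _).trans (Finset.sum_le_sum fun Ψ _ => ?_)
    rw [abs_mul]
    exact mul_le_of_le_one_left (abs_nonneg _) (hχ Ψ Λ)
  rw [← Finset.sum_subset (Finset.subset_univ S) (fun Λ _ hΛ => by
    rw [abs_eq_zero]; by_contra h; exact hΛ (hS Λ h))]
  refine (Finset.sum_le_sum fun Λ _ => key Λ).trans ?_
  rw [Finset.sum_const, nsmul_eq_mul, ← mul_assoc, div_eq_mul_inv]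

/-! ### The sign characters of `(ZMod 2)^ι × (ZMod 2)^ι` -/

section Sign

variable {σ : ZMod 2 → ℝ} (hσ : ∀ c, σ c = if c = 1 then -1 else 1)

include hσ in
/-- The sign `σ c = (-1)^c` is a character of `ZMod 2`. -/
theorem sgn_add (u v : ZMod 2) : σ (u + v) = σ u * σ v := by
  rcases (by decide : ∀ w : ZMod 2, w = 0 ∨ w = 1) v with rfl | rfl
  · rw [add_zero, hσ 0, if_neg (by decide), mul_one]
  · rcases (by decide : ∀ w : ZMod 2, w = 0 ∨ w = 1) u with rfl | rfl
    · rw [zero_add, hσ 0, if_neg (by decide), one_mul]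
    · rw [show (1 : ZMod 2) + 1 = 0 from by decide, hσ 0, hσ 1, if_neg (by decide), if_pos rfl]
      norm_num

include hσ in
/-- `|σ u| = 1`. -/
theorem abs_sgn (u : ZMod 2) : |σ u| = 1 := by
  rw [hσ u]
  split_ifs
  · rw [abs_neg, abs_one]
  · rw [abs_one]

include hσ in
/-- `σ` turns finite sums into products. -/
theorem sgn_sum {κ : Type*} (s : Finset κ) (f : κ → ZMod 2) : σ (∑ k ∈ s, f k) = ∏ k ∈ s, σ (f k) := by
  induction s using Finset.cons_induction with
  | empty => rw [Finset.sum_empty, Finset.prod_empty, hσ 0, if_neg (by decide)]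
  | cons a s ha ih => rw [Finset.sum_cons, Finset.prod_cons, sgn_add hσ, ih]

include hσ in
/-- `Σ_{c ∈ ZMod 2} σ (c * v) = 2 · [v = 0]`. -/
theorem sum_sgn_mul (v : ZMod 2) : ∑ c : ZMod 2, σ (c * v) = if v = 0 then 2 else 0 := by
  rw [show (Finset.univ : Finset (ZMod 2)) = {0, 1} from by decide,
    Finset.sum_pair (by decide : (0 : ZMod 2) ≠ 1), zero_mul, one_mul, hσ 0, if_neg (by decide), hσ v]
  rcases (by decide : ∀ w : ZMod 2, w = 0 ∨ w = 1) v with rfl | rfl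
  · rw [if_neg (by decide), if_pos rfl]; norm_num
  · rw [if_pos rfl, if_neg (by decide)]; norm_num

include hσ in
/-- ORTHOGONALITY of the sign characters of `(ZMod 2)^ι`: `Σ_ψ σ ⟨ψ, v⟩ = 2^|ι| · [v = 0]`
(product formula `Σ_ψ Π_j = Π_j Σ_c`). -/
theorem sum_sgn_dot {ι : Type*} [Fintype ι] [DecidableEq ι] (v : ι → ZMod 2) :
    ∑ ψ : ι → ZMod 2, σ (∑ j, ψ j * v j) = if v = 0 then (2 : ℝ) ^ Fintype.card ι else 0 := by
  simp only [sgn_sum hσ]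
  rw [← Fintype.prod_sum (fun j c => σ (c * v j))]
  simp only [sum_sgn_mul hσ]
  split_ifs with hv
  · subst hv
    simp only [Pi.zero_apply, if_true, Finset.prod_const, Finset.card_univ]
  · obtain ⟨j, hj⟩ : ∃ j, v j ≠ 0 := Function.ne_iff.1 hv
    exact Finset.prod_eq_zero (Finset.mem_univ j) (if_neg hj)

/-- In `(ZMod 2)^ι` (characteristic two), `u + w = 0 ↔ u = w`. -/
theorem add_eq_zero_iff_eq' {ι : Type*} (u w : ι → ZMod 2) : u + w = 0 ↔ u = w := by
  refine ⟨fun h => funext fun j => ?_, ?_⟩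
  · have hj := congr_fun h j
    rw [Pi.add_apply, Pi.zero_apply] at hj
    exact (by decide : ∀ a b : ZMod 2, a + b = 0 → a = b) _ _ hj
  · rintro rfl
    exact funext fun j => (by decide : ∀ a : ZMod 2, a + a = 0) _

include hσ in
/-- ORTHOGONALITY of the sign characters `χ_{ψ,ψ'}(π,π') = σ(⟨ψ,π⟩ + ⟨ψ',π'⟩)` of `(ZMod 2)^ι × (ZMod 2)^ι`. -/
theorem orth {ι : Type*} [Fintype ι] [DecidableEq ι] (Λ Λ' : (ι → ZMod 2) × (ι → ZMod 2)) :
    ∑ Ψ : (ι → ZMod 2) × (ι → ZMod 2), σ (∑ j, Ψ.1 j * Λ.1 j + ∑ j, Ψ.2 j * Λ.2 j) *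
        σ (∑ j, Ψ.1 j * Λ'.1 j + ∑ j, Ψ.2 j * Λ'.2 j) =
      if Λ = Λ' then (Fintype.card ((ι → ZMod 2) × (ι → ZMod 2)) : ℝ) else 0 := by
  have hdot : ∀ ψ v w : ι → ZMod 2, ∑ j, ψ j * v j + ∑ j, ψ j * w j = ∑ j, ψ j * (v + w) j := fun ψ v w => by
    rw [← Finset.sum_add_distrib]
    exact Finset.sum_congr rfl fun j _ => by rw [Pi.add_apply, mul_add]
  have h2 : ∀ Ψ : (ι → ZMod 2) × (ι → ZMod 2), σ (∑ j, Ψ.1 j * Λ.1 j + ∑ j, Ψ.2 j * Λ.2 j) *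
      σ (∑ j, Ψ.1 j * Λ'.1 j + ∑ j, Ψ.2 j * Λ'.2 j) =
        σ (∑ j, Ψ.1 j * (Λ + Λ').1 j) * σ (∑ j, Ψ.2 j * (Λ + Λ').2 j) := fun Ψ => by
    rw [← sgn_add hσ, ← sgn_add hσ, add_add_add_comm, hdot, hdot, Prod.fst_add, Prod.snd_add]
  have hcard : (Fintype.card ((ι → ZMod 2) × (ι → ZMod 2)) : ℝ) =
      (2 : ℝ) ^ Fintype.card ι * (2 : ℝ) ^ Fintype.card ι := by
    rw [Fintype.card_prod, Fintype.card_fun, ZMod.card]; push_cast; rfl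
  simp only [h2]
  rw [Fintype.sum_prod_type' fun u w : ι → ZMod 2 =>
      σ (∑ j, u j * (Λ + Λ').1 j) * σ (∑ j, w j * (Λ + Λ').2 j),
    ← Finset.sum_mul_sum, sum_sgn_dot hσ, sum_sgn_dot hσ, hcard]
  simp only [Prod.ext_iff, Prod.fst_add, Prod.snd_add, add_eq_zero_iff_eq']
  by_cases h1 : Λ.1 = Λ'.1 <;> by_cases h3 : Λ.2 = Λ'.2 <;> simp [h1, h3]

include hσ in
/-- `ℓ¹` FOURIER BOUND on `V × V`, `V = (ZMod 2)^ι`, for `g : V → V → ℝ` vanishing off `S`, with the Fourier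
coefficients supplied as a named function `Gf`: `Σ |g| ≤ (#S / |V|²) Σ_{ψ,ψ'} |Gf ψ ψ'|`. -/
theorem l1_le_of_support {ι : Type*} [Fintype ι] [DecidableEq ι] (g : (ι → ZMod 2) → (ι → ZMod 2) → ℝ)
    (S : Finset ((ι → ZMod 2) × (ι → ZMod 2))) (hS : ∀ π π', g π π' ≠ 0 → (π, π') ∈ S)
    (Gf : (ι → ZMod 2) → (ι → ZMod 2) → ℝ)
    (hG : ∀ ψ ψ', ∑ π : ι → ZMod 2, ∑ π' : ι → ZMod 2, σ (∑ j, ψ j * π j + ∑ j, ψ' j * π' j) * g π π' = Gf ψ ψ') :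
    ∑ π : ι → ZMod 2, ∑ π' : ι → ZMod 2, |g π π'| ≤
      S.card / ((Fintype.card (ι → ZMod 2) : ℝ)) ^ 2 * ∑ ψ : ι → ZMod 2, ∑ ψ' : ι → ZMod 2, |Gf ψ ψ'| := by
  have h := l1_le_card_mul_fourier (fun Ψ Λ : (ι → ZMod 2) × (ι → ZMod 2) =>
      σ (∑ j, Ψ.1 j * Λ.1 j + ∑ j, Ψ.2 j * Λ.2 j)) (fun Ψ Λ => (abs_sgn hσ _).le) (orth hσ)
    (fun Λ => g Λ.1 Λ.2) S (fun Λ hΛ => hS Λ.1 Λ.2 hΛ)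
  have hG' : ∀ Ψ : (ι → ZMod 2) × (ι → ZMod 2), ∑ Λ' : (ι → ZMod 2) × (ι → ZMod 2),
      σ (∑ j, Ψ.1 j * Λ'.1 j + ∑ j, Ψ.2 j * Λ'.2 j) * g Λ'.1 Λ'.2 = Gf Ψ.1 Ψ.2 := fun Ψ =>
    (Fintype.sum_prod_type' fun π π' => σ (∑ j, Ψ.1 j * π j + ∑ j, Ψ.2 j * π' j) * g π π').trans (hG Ψ.1 Ψ.2)
  simp only [hG'] at h
  rw [Fintype.card_prod, Nat.cast_mul, ← pow_two] at h
  calc ∑ π : ι → ZMod 2, ∑ π' : ι → ZMod 2, |g π π'|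
      = ∑ Λ : (ι → ZMod 2) × (ι → ZMod 2), |g Λ.1 Λ.2| := (Fintype.sum_prod_type' _).symm
    _ ≤ _ := h
    _ = _ := by rw [Fintype.sum_prod_type' fun ψ ψ' => |Gf ψ ψ'|]

end Sign

/-! ### The carry automaton: fibre sums, labels, twisted cell sums -/

/-- Fibrewise summation: summing a fibre sum against the fibre labels collapses to a single sum. -/
theorem sum_fiber_pair {α β γ : Type*} [Fintype β] [Fintype γ] [DecidableEq β] [DecidableEq γ]
    (s : Finset α) (P Q : α → Prop) [DecidablePred P] [DecidablePred Q] (f : α → β) (g : α → γ)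
    (h : β → γ → α → ℝ) :
    ∑ b, ∑ c, ∑ x ∈ s.filter (fun x => P x ∧ Q x ∧ f x = b ∧ g x = c), h b c x =
      ∑ x ∈ s.filter (fun x => P x ∧ Q x), h (f x) (g x) x := by
  rw [← Finset.sum_fiberwise (s.filter fun x => P x ∧ Q x) (fun x => (f x, g x))
    (fun x => h (f x) (g x) x), Fintype.sum_prod_type]
  refine Finset.sum_congr rfl fun b _ => Finset.sum_congr rfl fun c _ => ?_
  have hs : s.filter (fun x => P x ∧ Q x ∧ f x = b ∧ g x = c) =
      (s.filter fun x => P x ∧ Q x).filter (fun x => (f x, g x) = (b, c)) := by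
    ext y
    simp only [Finset.mem_filter, Prod.mk.injEq, and_assoc]
  rw [hs]
  refine Finset.sum_congr rfl fun y hy => ?_
  simp only [Finset.mem_filter, Prod.mk.injEq] at hy
  rw [hy.2.1, hy.2.2]

/-- `#{w ᵥ* C : w} ≤ 2^{rank C}` over `ZMod 2`: the image sits inside the range of `C.vecMulLinear`, an
`𝔽₂`-space of dimension `rank Cᵀ = rank C`. -/
theorem card_image_vecMul_le {n : ℕ} (C : Matrix (Fin n) (Fin n) (ZMod 2)) :
    (Finset.univ.image fun w : Fin n → ZMod 2 => Matrix.vecMul w C).card ≤ 2 ^ C.rank := by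
  let W : Submodule (ZMod 2) (Fin n → ZMod 2) := LinearMap.range C.vecMulLinear
  have hsub : (↑(Finset.univ.image fun w : Fin n → ZMod 2 => Matrix.vecMul w C) : Set (Fin n → ZMod 2)) ⊆
      (W : Set (Fin n → ZMod 2)) := by
    intro v hv
    rw [Finset.mem_coe, Finset.mem_image] at hv
    obtain ⟨w, -, rfl⟩ := hv
    exact LinearMap.mem_range_self C.vecMulLinear w
  have hW : Module.finrank (ZMod 2) W = C.rank := by
    rw [← Matrix.rank_transpose, Matrix.rank, Matrix.mulVecLin_transpose]
  calc (Finset.univ.image fun w : Fin n → ZMod 2 => Matrix.vecMul w C).card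
      = (↑(Finset.univ.image fun w : Fin n → ZMod 2 => Matrix.vecMul w C) : Set (Fin n → ZMod 2)).ncard :=
        (Set.ncard_coe_finset _).symm
    _ ≤ (W : Set (Fin n → ZMod 2)).ncard := Set.ncard_le_ncard hsub
    _ = Nat.card W := (Nat.card_coe_set_eq _).symm
    _ = 2 ^ C.rank := by rw [Module.natCard_eq_pow_finrank (K := ZMod 2), Nat.card_zmod, hW]

section Automaton

variable {p q n N : ℕ} {a : ℕ → ℕ → ZMod 2} {l : ℕ → ZMod 2} {σ : ZMod 2 → ℝ} {y : ℕ → ℕ → ZMod 2}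
  {lab : ℕ → Fin n → ZMod 2} {φ : ℕ → ZMod 2} {e : (Fin n → ZMod 2) → ℕ → ZMod 2}
  {Φ : (ℕ → ZMod 2) → (ℕ → ZMod 2) → ℕ → ZMod 2} {F : ℕ × ℕ → (Fin n → ZMod 2) → (Fin n → ZMod 2) → ℝ}
  {Gh : ℕ × ℕ → (ℕ → ZMod 2) → (ℕ → ZMod 2) → ℝ} {C : Matrix (Fin n) (Fin n) (ZMod 2)}
  (hσ : ∀ c, σ c = if c = 1 then -1 else 1)
  (hlab : ∀ m (j : Fin n), lab m j = if N ≤ (j : ℕ) then ∑ i ∈ Finset.range N, a i (j : ℕ) * y m i else 0)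
  (hφ : ∀ m, φ m = (∑ i ∈ Finset.range N, ∑ j ∈ Finset.range N, (if i < j then a i j * y m i * y m j else 0)) +
    ∑ i ∈ Finset.range N, l i * y m i)
  (he : ∀ (ψ : Fin n → ZMod 2) (j : Fin n), e ψ j = ψ j)
  (hΦ : ∀ ψ ψ' T, Φ ψ ψ' T = ∑ i ∈ Finset.range N, ∑ j ∈ Finset.range N, (if i < j then a i j *
    (y (p * T) i * y (p * T) j + y (q * T) i * y (q * T) j) else 0) +
    ∑ i ∈ Finset.range N, ((l i + ∑ j ∈ Finset.range n, (if N ≤ j then ψ j * a i j else 0)) * y (p * T) i +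
      (l i + ∑ j ∈ Finset.range n, (if N ≤ j then ψ' j * a i j else 0)) * y (q * T) i))
  (hF : ∀ x π π', F x π π' = ∑ T ∈ (Finset.range (2 ^ N)).filter (fun T => p * T / 2 ^ N = x.1 ∧
    q * T / 2 ^ N = x.2 ∧ lab (p * T) = π ∧ lab (q * T) = π'), σ (φ (p * T) + φ (q * T)))
  (hGh : ∀ x ψ ψ', Gh x ψ ψ' = ∑ T ∈ (Finset.range (2 ^ N)).filter
    (fun T => p * T / 2 ^ N = x.1 ∧ q * T / 2 ^ N = x.2), σ (Φ ψ ψ' T))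
  (hC : ∀ i j, C i j = if (i : ℕ) < N ∧ N ≤ (j : ℕ) then a i j else 0) (hNn : N ≤ n)

include hlab he in
/-- `⟨ψ, lab(m)⟩ = Σ_{i<N} (Σ_{j ∈ [N,n)} ψ j a i j) · y m i` (with `ψ` extended by zero to `ℕ`). -/
theorem dot_lab (ψ : Fin n → ZMod 2) (m : ℕ) : ∑ j, ψ j * lab m j =
    ∑ i ∈ Finset.range N, (∑ j ∈ Finset.range n, (if N ≤ j then e ψ j * a i j else 0)) * y m i := by
  have h1 : ∀ j : Fin n, ψ j * lab m j = ∑ i ∈ Finset.range N, (if N ≤ (j : ℕ) then ψ j * a i j else 0) * y m i :=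
      fun j => by
    rw [hlab]
    split_ifs with hj
    · rw [Finset.mul_sum]; exact Finset.sum_congr rfl fun i _ => by ring
    · rw [mul_zero]; exact (Finset.sum_eq_zero fun i _ => zero_mul _).symm
  simp only [h1]
  rw [Finset.sum_comm]
  refine Finset.sum_congr rfl fun i _ => ?_
  rw [← Finset.sum_mul, Finset.sum_range]
  congr 1
  exact Finset.sum_congr rfl fun j _ => by rw [he]

include hlab he hφ hΦ in
/-- The twist identity: the twisted phase at the extended characters is the fibre phase plus the character
pairing with the labels. -/
theorem twist_eq (ψ ψ' : Fin n → ZMod 2) (T : ℕ) : Φ (e ψ) (e ψ') T =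
    ∑ j, ψ j * lab (p * T) j + ∑ j, ψ' j * lab (q * T) j + (φ (p * T) + φ (q * T)) := by
  rw [dot_lab hlab he, dot_lab hlab he, hΦ, hφ, hφ]
  have hsplit : ∀ i, ∑ j ∈ Finset.range N, (if i < j then a i j * (y (p * T) i * y (p * T) j +
      y (q * T) i * y (q * T) j) else 0) =
      ∑ j ∈ Finset.range N, (if i < j then a i j * y (p * T) i * y (p * T) j else 0) +
        ∑ j ∈ Finset.range N, (if i < j then a i j * y (q * T) i * y (q * T) j else 0) := fun i => by
    rw [← Finset.sum_add_distrib]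
    exact Finset.sum_congr rfl fun j _ => by split_ifs <;> ring
  simp only [← Finset.sum_add_distrib]
  refine Finset.sum_congr rfl fun i _ => ?_
  rw [hsplit i]
  ring

include hσ hlab he hφ hΦ hF hGh in
/-- THE FOURIER COEFFICIENT of the fibre sums at the cell `x` is the twisted cell sum at the characters
extended by zero. -/
theorem coeff_eq (x : ℕ × ℕ) (ψ ψ' : Fin n → ZMod 2) :
    ∑ π : Fin n → ZMod 2, ∑ π' : Fin n → ZMod 2, σ (∑ j, ψ j * π j + ∑ j, ψ' j * π' j) * F x π π' =
      Gh x (e ψ) (e ψ') := by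
  simp only [hF, Finset.mul_sum]
  rw [sum_fiber_pair (Finset.range (2 ^ N)) (fun T => p * T / 2 ^ N = x.1) (fun T => q * T / 2 ^ N = x.2)
    (fun T => lab (p * T)) (fun T => lab (q * T))
    (fun π π' T => σ (∑ j, ψ j * π j + ∑ j, ψ' j * π' j) * σ (φ (p * T) + φ (q * T))), hGh]
  refine Finset.sum_congr rfl fun T _ => ?_
  rw [← sgn_add hσ, twist_eq hlab hφ he hΦ]

include hlab hC hNn in
/-- The pending label of `m` is the row-space vector `y(m) ᵥ* C` of the cut matrix. -/
theorem lab_eq_vecMul (m : ℕ) : lab m = Matrix.vecMul (fun i : Fin n => y m i) C := by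
  funext j
  simp only [hlab, Matrix.vecMul, dotProduct, hC]
  symm
  refine (Fin.sum_univ_eq_sum_range (fun k => y m k * (if k < N ∧ N ≤ (j : ℕ) then a k j else 0)) n).trans ?_
  rw [← Finset.sum_range_add_sum_Ico _ hNn]
  have hz : ∑ k ∈ Finset.Ico N n, y m k * (if k < N ∧ N ≤ (j : ℕ) then a k j else 0) = 0 :=
    Finset.sum_eq_zero fun k hk => by rw [if_neg (fun h => not_lt.2 (Finset.mem_Ico.1 hk).1 h.1), mul_zero]
  rw [hz, add_zero]
  by_cases hj : N ≤ (j : ℕ)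
  · rw [if_pos hj]
    exact Finset.sum_congr rfl fun k hk => by rw [if_pos ⟨Finset.mem_range.1 hk, hj⟩, mul_comm]
  · rw [if_neg hj]
    exact Finset.sum_eq_zero fun k _ => by rw [if_neg (fun h => hj h.2), mul_zero]

include hσ hlab hφ he hΦ hF hGh hC hNn in
/-- THE LABEL FOURIER BOUND in abstract form: cut rank `< R₀` and twisted cell sums `≤ M` give
`Σ_{x,π,π'} |F x π π'| ≤ 4^(R₀−1) · M`. -/
theorem main_bound {R₀ : ℕ} {M : ℝ} (hrank : C.rank < R₀)
    (hM : ∀ ψ ψ' : ℕ → ZMod 2, ∑ x ∈ Finset.range p ×ˢ Finset.range q, |Gh x ψ ψ'| ≤ M) :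
    ∑ x ∈ Finset.range p ×ˢ Finset.range q, ∑ π : Fin n → ZMod 2, ∑ π' : Fin n → ZMod 2, |F x π π'| ≤
      (4 : ℝ) ^ (R₀ - 1) * M := by
  -- support of the fibre sums and its size
  have hsupp : ∀ x (π π' : Fin n → ZMod 2), F x π π' ≠ 0 →
      (π, π') ∈ (Finset.univ.image fun w : Fin n → ZMod 2 => Matrix.vecMul w C) ×ˢ
        (Finset.univ.image fun w : Fin n → ZMod 2 => Matrix.vecMul w C) := by
    intro x π π' hne
    rw [hF] at hne
    obtain ⟨T, hT, -⟩ := Finset.exists_ne_zero_of_sum_ne_zero hne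
    rw [Finset.mem_filter] at hT
    obtain ⟨-, -, -, rfl, rfl⟩ := hT
    rw [Finset.mem_product, lab_eq_vecMul hlab hC hNn, lab_eq_vecMul hlab hC hNn]
    exact ⟨Finset.mem_image_of_mem _ (Finset.mem_univ _), Finset.mem_image_of_mem _ (Finset.mem_univ _)⟩
  have hcardS : (((Finset.univ.image fun w : Fin n → ZMod 2 => Matrix.vecMul w C) ×ˢ
      (Finset.univ.image fun w : Fin n → ZMod 2 => Matrix.vecMul w C)).card : ℝ) ≤ (4 : ℝ) ^ (R₀ - 1) := by
    have h1 := (card_image_vecMul_le C).trans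
      (Nat.pow_le_pow_right (by norm_num) (Nat.le_sub_one_of_lt hrank))
    rw [Finset.card_product]
    calc _ ≤ ((2 ^ (R₀ - 1) * 2 ^ (R₀ - 1) : ℕ) : ℝ) := by exact_mod_cast Nat.mul_le_mul h1 h1
      _ = (4 : ℝ) ^ (R₀ - 1) := by push_cast; rw [← mul_pow]; norm_num
  -- Fourier bound cell by cell, then average the hypothesis over the characters
  set V : ℝ := (Fintype.card (Fin n → ZMod 2) : ℝ) with hV
  have hVpos : 0 < V := by rw [hV]; exact_mod_cast Fintype.card_pos
  calc ∑ x ∈ Finset.range p ×ˢ Finset.range q, ∑ π : Fin n → ZMod 2, ∑ π' : Fin n → ZMod 2, |F x π π'|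
      ≤ ∑ x ∈ Finset.range p ×ˢ Finset.range q, (4 : ℝ) ^ (R₀ - 1) / V ^ 2 *
          ∑ ψ : Fin n → ZMod 2, ∑ ψ' : Fin n → ZMod 2, |Gh x (e ψ) (e ψ')| :=
        Finset.sum_le_sum fun x _ => (l1_le_of_support hσ (F x) _ (hsupp x) (fun ψ ψ' => Gh x (e ψ) (e ψ'))
          (coeff_eq hσ hlab hφ he hΦ hF hGh x)).trans
          (mul_le_mul_of_nonneg_right (div_le_div_of_nonneg_right hcardS (by positivity)) (by positivity))
    _ = (4 : ℝ) ^ (R₀ - 1) / V ^ 2 * ∑ ψ : Fin n → ZMod 2, ∑ ψ' : Fin n → ZMod 2,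
          ∑ x ∈ Finset.range p ×ˢ Finset.range q, |Gh x (e ψ) (e ψ')| := by
        rw [← Finset.mul_sum]
        exact congrArg _ (Finset.sum_comm.trans (Finset.sum_congr rfl fun ψ _ => Finset.sum_comm))
    _ ≤ (4 : ℝ) ^ (R₀ - 1) / V ^ 2 * ∑ ψ : Fin n → ZMod 2, ∑ ψ' : Fin n → ZMod 2, M :=
        mul_le_mul_of_nonneg_left
          (Finset.sum_le_sum fun ψ _ => Finset.sum_le_sum fun ψ' _ => hM (e ψ) (e ψ')) (by positivity)
    _ = (4 : ℝ) ^ (R₀ - 1) * M := by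
        simp only [Finset.sum_const, Finset.card_univ, nsmul_eq_mul, ← hV]
        field_simp

end Automaton

/-! ### The stub -/

/-- LABEL FOURIER REDUCTION (stub `stub_labelFourier` of crux stmt-QuantumAdvantage-1391, line Sketch):
for a solution `μ` of the transfer recursion and cut rank `< R₀` at the cut `N`, the `ℓ¹` mass satisfies
`Σ_{x,π,π'} |μ N x π π'| ≤ 4^(R₀−1) · M` whenever every label-character twist of the phase has cell sum
`≤ M` (`main_bound` at the fibre sums of `…RankCoreFibre.eq_fibA_of_recursion`; see the module doc). -/
theorem stub_labelFourier :
    ∀ (p q n N R₀ : ℕ) (a : ℕ → ℕ → ZMod 2) (l : ℕ → ZMod 2) (M : ℝ), 0 < p → 0 < q → N ≤ n →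
      (Matrix.of fun (i j : Fin n) => if (i : ℕ) < N ∧ N ≤ (j : ℕ) then a i j else 0).rank < R₀ →
      (∀ ψ ψ' : ℕ → ZMod 2, ∑ x ∈ Finset.range p ×ˢ Finset.range q, |∑ T ∈ (Finset.range (2 ^ N)).filter (fun T => p * T / 2 ^ N = x.1 ∧ q * T / 2 ^ N = x.2), (if (∑ i ∈ Finset.range N, ∑ j ∈ Finset.range N, (if i < j then a i j * ((if Nat.testBit (p * T) i then (1 : ZMod 2) else 0) * (if Nat.testBit (p * T) j then (1 : ZMod 2) else 0) + (if Nat.testBit (q * T) i then (1 : ZMod 2) else 0) * (if Nat.testBit (q * T) j then (1 : ZMod 2) else 0)) else 0) + ∑ i ∈ Finset.range N, ((l i + ∑ j ∈ Finset.range n, (if N ≤ j then ψ j * a i j else 0)) * (if Nat.testBit (p * T) i then (1 : ZMod 2) else 0) + (l i + ∑ j ∈ Finset.range n, (if N ≤ j then ψ' j * a i j else 0)) * (if Nat.testBit (q * T) i then (1 : ZMod 2) else 0))) = 1 then (-1 : ℝ) else 1)| ≤ M) →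
      ∀ μ : ℕ → ℕ × ℕ → (Fin n → ZMod 2) → (Fin n → ZMod 2) → ℝ, (∀ x π π', μ 0 x π π' = if x = (0, 0) ∧ π = 0 ∧ π' = 0 then 1 else 0) →
      (∀ N', N' < N → ∀ x' ρ ρ', μ (N' + 1) x' ρ ρ' =
          ∑ x ∈ Finset.range p ×ˢ Finset.range q, ∑ π : Fin n → ZMod 2, ∑ π' : Fin n → ZMod 2, ∑ t ∈ Finset.range 2,
            (if ((p * t + x.1) / 2 = x'.1 ∧ (q * t + x.2) / 2 = x'.2 ∧ (fun j : Fin n => if N' + 1 ≤ (j : ℕ) then π j + a N' (j : ℕ) * (if (p * t + x.1) % 2 = 1 then (1 : ZMod 2) else 0) else 0) = ρ ∧ (fun j : Fin n => if N' + 1 ≤ (j : ℕ) then π' j + a N' (j : ℕ) * (if (q * t + x.2) % 2 = 1 then (1 : ZMod 2) else 0) else 0) = ρ') then (if (if (p * t + x.1) % 2 = 1 then (1 : ZMod 2) else 0) * ((if h : N' < n then π ⟨N', h⟩ else 0) + l N') + (if (q * t + x.2) % 2 = 1 then (1 : ZMod 2) else 0) * ((if h : N' < n then π' ⟨N', h⟩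 else 0) + l N') = 1 then (-1 : ℝ) else 1) * μ N' x π π' else 0)) →
      ∑ x ∈ Finset.range p ×ˢ Finset.range q, ∑ π : Fin n → ZMod 2, ∑ π' : Fin n → ZMod 2, |μ N x π π'| ≤ (4 : ℝ) ^ (R₀ - 1) * M := by
  intro p q n N R₀ a l M hp hq hNn hrank hM μ h0 hrec
  have hμ := Summit.QuantumAdvantage.QuantumAdvantage.Theorems.MobiusLadderQuadraticDigitPhasesRankCoreFibre.eq_fibA_of_recursion
    p q n N a l _ μ (fun _ _ _ _ => rfl) hp hq hNn h0 hrec N le_rfl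
  exact main_bound (p := p) (q := q) (a := a) (l := l) (σ := fun c => if c = 1 then (-1 : ℝ) else 1)
    (y := fun m i => if Nat.testBit m i then (1 : ZMod 2) else 0)
    (e := fun ψ j => if h : j < n then ψ ⟨j, h⟩ else 0) (F := μ N)
    (fun _ => rfl) (fun _ _ => rfl) (fun _ => rfl) (fun ψ j => dif_pos j.2) (fun _ _ _ => rfl) hμ
    (fun _ _ _ => rfl) (fun _ _ => rfl) hNn hrank hM

end Summit.QuantumAdvantage.QuantumAdvantage.Theorems.MobiusLadderQuadraticDigitPhasesStubLabelFourier
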